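import Literature.Geometry.Lorentzian.LocalConstraintDeformation
import HarnessLib

/-!
# LocalConstraintDeformation — proofs companion: the squash reparametrisation (step (iv))

Companion of `Literature/Geometry/Lorentzian/LocalConstraintDeformation.lean`, which vendors the
named fact `ChruscielDelay_localConstraintDeformation` (Chruściel–Delay, Mém. SMF 94 (2003),
Thm. 5.9, Prop. 5.10, Cor. 5.11; J. Geom. Phys. 51 (2004), Thm. 6.6; Corvino–Schoen, J. Differential
Geom. 73 (2006), Thm. 2; Moncrief, J. Math. Phys. 16 (1975), §III). The docstring of that fact
assembles it from the printed sources in four steps (i)–(iv). Steps (i)–(iii) — no KIDs on a small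
coordinate ball `B ∋ x₀` (Moncrief), the KID-free vacuum data on `B̄` agreeing with `D` to infinite
order at `∂B` form a `C^∞` Banach submanifold modelled on `ker P` (Chruściel–Delay 2004, Thm. 6.6),
and weighted regularity plus extension by `D` off `B̄` give a jointly smooth `k`-parameter family of
vacuum data on a small PARAMETER BALL `‖c‖ < r` with the prescribed tangents (Chruściel–Delay 2003,
Cor. 5.11) — require weighted Sobolev/Hölder theory on compact manifolds with boundary, the Banach
inverse function theorem into `C^∞` and the Killing development of KIDs, none of which the tree has.
Step (iv) is elementary and is PROVED here: a family defined and smooth only on the parameter ball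
`‖c‖ < r` is turned into a family on all of `ℝᵏ` by the squash `c ↦ (ε/√(1+|c|²)) c`, `ε = r/2`,
which is a diffeomorphism of `ℝᵏ` onto the open `ε`-ball fixing `0` with differential `ε · id` at
`0`; the tangents get multiplied by `ε ≠ 0`, exactly as the conclusion of the fact allows.

* §1 `deriv_comp_eq_smul_deriv_of_hasStrictDerivAt`: for ANY curve `φ : ℝ → F` and a
  reparametrisation `τ` with `τ 0 = 0` and strict derivative `e ≠ 0` at `0`,
  `deriv (φ ∘ τ) 0 = e • deriv φ 0` — including Mathlib's junk value `deriv = 0` at a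
  non-differentiable point (a local diffeomorphism preserves non-differentiability), so that the
  fibrewise `deriv`-tangents of the fact transform correctly with no differentiability bookkeeping.
* §2 the squash map: smoothness, it maps into the `ε`-ball, and on a coordinate axis it is the
  one-variable squash `s ↦ ε s/√(1+s²)` (strict derivative `ε` at `0`).
* §3 `InitialDataSet.exists_smoothDataFamily_of_localFamily` (step (iv) for one datum) and the
  reduction `ChruscielDelay_localConstraintDeformation_of_localFamily`: the fact follows from its
  own statement with the conclusion replaced by the LOCAL, un-squashed family of steps (i)–(iii)
  (hypothesis `H`, stated inline over the same vocabulary; it is the part of the assembly that is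
  not formalised, and it is NOT asserted here).

No new definitions, no new named facts, no axioms: this file lowers the fact to its analytic core
and does not discharge it.
-/

noncomputable section

open scoped Manifold ContDiff Topology
open Set Filter Bundle

namespace Literature.Geometry.Lorentzian

/-! ## §1 Reparametrising a curve by a local diffeomorphism of the parameter line -/

/-- **Chain rule at a local diffeomorphism of the parameter, junk value included.** If `τ : ℝ → ℝ`
has a non-zero strict derivative `e` at `0` and `τ 0 = 0`, then for every curve `φ` in a real
normed space `deriv (φ ∘ τ) 0 = e • deriv φ 0`: for `φ` differentiable at `0` this is the chain
rule; otherwise `φ ∘ τ` is not differentiable at `0` either (compose with the local inverse of `τ`,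
Mathlib's `HasStrictDerivAt.localInverse`), so both sides are Mathlib's junk value `0`. [folklore] -/
theorem deriv_comp_eq_smul_deriv_of_hasStrictDerivAt {F : Type*} [NormedAddCommGroup F]
    [NormedSpace ℝ F] (φ : ℝ → F) {τ : ℝ → ℝ} {e : ℝ} (hτ : HasStrictDerivAt τ e 0) (he : e ≠ 0)
    (hτ0 : τ 0 = 0) : deriv (fun s ↦ φ (τ s)) 0 = e • deriv φ 0 := by
  by_cases hφ : DifferentiableAt ℝ φ 0
  · have h1 : HasDerivAt φ (deriv φ 0) (τ 0) := by
      rw [hτ0]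
      exact hφ.hasDerivAt
    exact (h1.scomp 0 hτ.hasDerivAt).deriv
  · -- `g` := the local inverse of `τ` at `0`; `φ = (φ ∘ τ) ∘ g` near `0`
    have hcomp : ¬ DifferentiableAt ℝ (fun s ↦ φ (τ s)) 0 := by
      intro h
      apply hφ
      have hgd : DifferentiableAt ℝ (hτ.localInverse τ e 0 he) 0 := by
        have := (hτ.to_localInverse he).hasDerivAt.differentiableAt
        rwa [hτ0] at this
      have hright : ∀ᶠ y in 𝓝 (0 : ℝ), τ (hτ.localInverse τ e 0 he y) = y := by
        have := hτ.eventually_right_inverse he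
        rwa [hτ0] at this
      have hg0 : hτ.localInverse τ e 0 he 0 = 0 := by
        have := (hτ.eventually_left_inverse he).self_of_nhds
        rwa [hτ0] at this
      have heq : (fun y ↦ φ (τ (hτ.localInverse τ e 0 he y))) =ᶠ[𝓝 0] φ := by
        filter_upwards [hright] with y hy
        rw [hy]
      refine heq.differentiableAt_iff.1 ?_
      have h' : DifferentiableAt ℝ (fun s ↦ φ (τ s)) (hτ.localInverse τ e 0 he 0) := by rwa [hg0]
      exact h'.comp 0 hgd
    rw [deriv_zero_of_not_differentiableAt hcomp, deriv_zero_of_not_differentiableAt hφ, smul_zero]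

/-! ## §2 The squash map `c ↦ (ε/√(1+|c|²)) c` -/

/-- The squash map `c ↦ (ε/√(1+|c|²)) c` of `ℝᵏ` is smooth. [folklore] -/
theorem contDiff_squash (k : ℕ) (ε : ℝ) :
    ContDiff ℝ ∞ (fun c : EuclideanSpace ℝ (Fin k) ↦ (ε / Real.sqrt (1 + ‖c‖ ^ 2)) • c) := by
  have h1 : ContDiff ℝ ∞ (fun c : EuclideanSpace ℝ (Fin k) ↦ 1 + ‖c‖ ^ 2) :=
    contDiff_const.add (contDiff_norm_sq ℝ)
  have h3 : ContDiff ℝ ∞ (fun c : EuclideanSpace ℝ (Fin k) ↦ Real.sqrt (1 + ‖c‖ ^ 2)) :=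
    h1.sqrt fun c ↦ by positivity
  have h4 : ∀ c : EuclideanSpace ℝ (Fin k), Real.sqrt (1 + ‖c‖ ^ 2) ≠ 0 := fun c ↦
    (Real.sqrt_pos.2 (by positivity)).ne'
  exact (contDiff_const.div h3 h4).smul contDiff_id

/-- The squash map with parameter `ε > 0` takes values in the open `ε`-ball:
`|ε c/√(1+|c|²)| < ε`. [folklore] -/
theorem norm_squash_lt {k : ℕ} {ε : ℝ} (hε : 0 < ε) (c : EuclideanSpace ℝ (Fin k)) :
    ‖(ε / Real.sqrt (1 + ‖c‖ ^ 2)) • c‖ < ε := by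
  have hs : 0 < Real.sqrt (1 + ‖c‖ ^ 2) := Real.sqrt_pos.2 (by positivity)
  have hlt : ‖c‖ < Real.sqrt (1 + ‖c‖ ^ 2) := by
    rw [Real.lt_sqrt (norm_nonneg c)]
    linarith
  rw [norm_smul, norm_div, Real.norm_of_nonneg hε.le, Real.norm_of_nonneg hs.le,
    div_mul_eq_mul_div, div_lt_iff₀ hs]
  exact mul_lt_mul_of_pos_left hlt hε

/-- On a coordinate axis the squash map is the one-variable squash:
`(ε/√(1+|s eⱼ|²)) (s eⱼ) = (ε s/√(1+s²)) eⱼ`. [folklore] -/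
theorem squash_single {k : ℕ} (ε : ℝ) (j : Fin k) (s : ℝ) :
    (ε / Real.sqrt (1 + ‖EuclideanSpace.single j s‖ ^ 2)) • EuclideanSpace.single j s =
      EuclideanSpace.single j (ε * s / Real.sqrt (1 + s ^ 2)) := by
  rw [PiLp.norm_single, Real.norm_eq_abs, sq_abs]
  ext i
  rw [PiLp.smul_apply, PiLp.single_apply, PiLp.single_apply, smul_eq_mul]
  split_ifs
  · ring
  · ring

/-- The one-variable squash `s ↦ ε s/√(1+s²)` has strict derivative `ε` at `0`. [folklore] -/
theorem hasStrictDerivAt_squash₁ (ε : ℝ) :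
    HasStrictDerivAt (fun s : ℝ ↦ ε * s / Real.sqrt (1 + s ^ 2)) ε 0 := by
  have h1 : HasDerivAt (fun s : ℝ ↦ ε * s) ε 0 := by
    simpa using (hasDerivAt_id (0 : ℝ)).const_mul ε
  have h2 : HasDerivAt (fun s : ℝ ↦ 1 + s ^ 2) 0 0 := by
    simpa using (hasDerivAt_pow 2 (0 : ℝ)).const_add 1
  have h3 : HasDerivAt (fun s : ℝ ↦ Real.sqrt (1 + s ^ 2)) 0 0 := by
    simpa using h2.sqrt (by norm_num)
  have h4 : HasDerivAt (fun s : ℝ ↦ ε * s / Real.sqrt (1 + s ^ 2)) ε 0 := by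
    refine (h1.fun_div h3 (by norm_num)).congr_deriv ?_
    simp
  have hc : ContDiff ℝ ∞ (fun s : ℝ ↦ ε * s / Real.sqrt (1 + s ^ 2)) := by
    refine (contDiff_const.mul contDiff_id).div
      ((contDiff_const.add (contDiff_id.pow 2)).sqrt fun x ↦ ?_) fun x ↦ ?_
    · positivity
    · exact (Real.sqrt_pos.2 (by positivity)).ne'
  exact hc.contDiffAt.hasStrictDerivAt' h4 (by simp)

/-! ## §3 Step (iv): from a local family on a parameter ball to the conclusion of the fact -/

section Reduction

variable {X : Type} [TopologicalSpace X] [ChartedSpace E3 X] [IsManifold (𝓡 3) ∞ X]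

/-- **Step (iv) of the assembly of `ChruscielDelay_localConstraintDeformation`, for one datum.**
Let `G₀ : ℝᵏ → data` be a family through `D = G₀ 0` which, on the parameter ball `‖c‖ < r`, is
jointly smooth in `(c, x)` (both `h` and `k` as maps into the bundle of bilinear forms), solves the
vacuum constraints, agrees with `D` off a compact `K' ⊆ V`, and whose fibrewise `s`-derivatives at
`0` along the coordinate axes are the prescribed fields `(aⱼ, bⱼ)`. Then the squashed family
`G c := G₀ (ε c/√(1+|c|²))`, `ε := r/2`, is a jointly smooth `k`-parameter family on all of `ℝᵏ`
(`InitialDataSet.IsSmoothDataFamily`) of vacuum data through `D`, equal to `D` off `K'`, with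
tangents `ε (aⱼ, bⱼ)` — the conclusion of the fact. (The squash is a diffeomorphism of `ℝᵏ` onto
the `ε`-ball with differential `ε · id` at `0`; along the `j`-th axis it is `s ↦ (ε s/√(1+s²)) eⱼ`,
`squash_single`, and `deriv_comp_eq_smul_deriv_of_hasStrictDerivAt` transports the fibrewise
`deriv`s, junk values included.) [folklore] -/
theorem InitialDataSet.exists_smoothDataFamily_of_localFamily (D : InitialDataSet (𝓡 3) X)
    (V : Set X) {k : ℕ}
    (a b : Fin k → Π x : X, TangentSpace (𝓡 3) x →L[ℝ] TangentSpace (𝓡 3) x →L[ℝ] ℝ)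
    {r : ℝ} (hr : 0 < r) (G₀ : EuclideanSpace ℝ (Fin k) → InitialDataSet (𝓡 3) X)
    (hh : ContMDiffOn (𝓘(ℝ, EuclideanSpace ℝ (Fin k)).prod (𝓡 3))
      ((𝓡 3).prod 𝓘(ℝ, E3 →L[ℝ] E3 →L[ℝ] ℝ)) ∞
      (fun p : EuclideanSpace ℝ (Fin k) × X ↦
        TotalSpace.mk' (F := E3 →L[ℝ] E3 →L[ℝ] ℝ)
          (E := fun x : X ↦ TangentSpace (𝓡 3) x →L[ℝ] TangentSpace (𝓡 3) x →L[ℝ] ℝ) p.2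
          ((G₀ p.1).h.inner p.2))
      (Metric.ball (0 : EuclideanSpace ℝ (Fin k)) r ×ˢ (univ : Set X)))
    (hk : ContMDiffOn (𝓘(ℝ, EuclideanSpace ℝ (Fin k)).prod (𝓡 3))
      ((𝓡 3).prod 𝓘(ℝ, E3 →L[ℝ] E3 →L[ℝ] ℝ)) ∞
      (fun p : EuclideanSpace ℝ (Fin k) × X ↦
        TotalSpace.mk' (F := E3 →L[ℝ] E3 →L[ℝ] ℝ)
          (E := fun x : X ↦ TangentSpace (𝓡 3) x →L[ℝ] TangentSpace (𝓡 3) x →L[ℝ] ℝ) p.2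
          ((G₀ p.1).k p.2))
      (Metric.ball (0 : EuclideanSpace ℝ (Fin k)) r ×ˢ (univ : Set X)))
    (h0 : G₀ 0 = D)
    (hvac : ∀ c : EuclideanSpace ℝ (Fin k), ‖c‖ < r →
      ∀ [(G₀ c).metric.HasLeviCivita], (G₀ c).IsVacuumConstraintSolution)
    (hsupp : ∃ K' : Set X, IsCompact K' ∧ K' ⊆ V ∧
      ∀ c : EuclideanSpace ℝ (Fin k), ‖c‖ < r → ∀ x : X, x ∉ K' →
        (G₀ c).h.inner x = D.h.inner x ∧ (G₀ c).k x = D.k x)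
    (htan : ∀ j, (fun x : X ↦ deriv (fun s : ℝ ↦ (show E3 →L[ℝ] E3 →L[ℝ] ℝ from
        (G₀ (EuclideanSpace.single j s)).h.inner x)) 0) = a j ∧
      (fun x : X ↦ deriv (fun s : ℝ ↦ (show E3 →L[ℝ] E3 →L[ℝ] ℝ from
        (G₀ (EuclideanSpace.single j s)).k x)) 0) = b j) :
    ∃ (G : EuclideanSpace ℝ (Fin k) → InitialDataSet (𝓡 3) X) (ε : ℝ), ε ≠ 0 ∧
      InitialDataSet.IsSmoothDataFamily k G ∧ G 0 = D ∧
      (∀ c, ∀ [(G c).metric.HasLeviCivita], (G c).IsVacuumConstraintSolution) ∧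
      (∃ K' : Set X, IsCompact K' ∧ K' ⊆ V ∧
        ∀ (c : EuclideanSpace ℝ (Fin k)) (x : X), x ∉ K' →
          (G c).h.inner x = D.h.inner x ∧ (G c).k x = D.k x) ∧
      ∀ j, (fun x : X ↦ deriv (fun s : ℝ ↦ (show E3 →L[ℝ] E3 →L[ℝ] ℝ from
          (G (EuclideanSpace.single j s)).h.inner x)) 0) = ε • a j ∧
        (fun x : X ↦ deriv (fun s : ℝ ↦ (show E3 →L[ℝ] E3 →L[ℝ] ℝ from
          (G (EuclideanSpace.single j s)).k x)) 0) = ε • b j := by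
  obtain ⟨K', hK'c, hK'V, hsupp⟩ := hsupp
  have hε : (0 : ℝ) < r / 2 := by positivity
  have hball : ∀ c : EuclideanSpace ℝ (Fin k), ‖(r / 2 / Real.sqrt (1 + ‖c‖ ^ 2)) • c‖ < r :=
    fun c ↦ (norm_squash_lt hε c).trans (by linarith)
  have hτ := hasStrictDerivAt_squash₁ (r / 2)
  have hτ0 : r / 2 * 0 / Real.sqrt (1 + (0 : ℝ) ^ 2) = 0 := by simp
  refine ⟨fun c ↦ G₀ ((r / 2 / Real.sqrt (1 + ‖c‖ ^ 2)) • c), r / 2, hε.ne', ?_, ?_, ?_,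
    ⟨K', hK'c, hK'V, fun c x hx ↦ hsupp _ (hball c) x hx⟩, fun j ↦ ⟨?_, ?_⟩⟩
  · -- joint smoothness on all of `ℝᵏ × X`: compose with the (smooth) squash, which maps into the ball
    have hσ : ContMDiff 𝓘(ℝ, EuclideanSpace ℝ (Fin k)) 𝓘(ℝ, EuclideanSpace ℝ (Fin k)) ∞
        (fun c : EuclideanSpace ℝ (Fin k) ↦ (r / 2 / Real.sqrt (1 + ‖c‖ ^ 2)) • c) :=
      (contDiff_squash k (r / 2)).contMDiff
    have hmap : ContMDiff (𝓘(ℝ, EuclideanSpace ℝ (Fin k)).prod (𝓡 3))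
        (𝓘(ℝ, EuclideanSpace ℝ (Fin k)).prod (𝓡 3)) ∞
        (fun p : EuclideanSpace ℝ (Fin k) × X ↦
          ((r / 2 / Real.sqrt (1 + ‖p.1‖ ^ 2)) • p.1, p.2)) :=
      (hσ.comp contMDiff_fst).prodMk contMDiff_snd
    have hmem : ∀ p : EuclideanSpace ℝ (Fin k) × X,
        ((r / 2 / Real.sqrt (1 + ‖p.1‖ ^ 2)) • p.1, p.2) ∈
          Metric.ball (0 : EuclideanSpace ℝ (Fin k)) r ×ˢ (univ : Set X) :=
      fun p ↦ ⟨mem_ball_zero_iff.2 (hball p.1), mem_univ _⟩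
    exact ⟨hh.comp_contMDiff hmap hmem, hk.comp_contMDiff hmap hmem⟩
  · show G₀ ((r / 2 / Real.sqrt (1 + ‖(0 : EuclideanSpace ℝ (Fin k))‖ ^ 2)) • 0) = D
    rw [smul_zero]
    exact h0
  · intro c
    exact hvac _ (hball c)
  · -- tangents, metric part: along the `j`-th axis the squashed family is the curve
    -- `s ↦ G₀ (s eⱼ)` reparametrised by the one-variable squash (`squash_single`)
    funext x
    have hx : deriv (fun u : ℝ ↦ (show E3 →L[ℝ] E3 →L[ℝ] ℝ from
        (G₀ (EuclideanSpace.single j u)).h.inner x)) 0 = a j x := congrFun (htan j).1 x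
    have key : deriv (fun s : ℝ ↦ (show E3 →L[ℝ] E3 →L[ℝ] ℝ from
        (G₀ ((r / 2 / Real.sqrt (1 + ‖EuclideanSpace.single j s‖ ^ 2)) •
          EuclideanSpace.single j s)).h.inner x)) 0 =
        (r / 2) • deriv (fun u : ℝ ↦ (show E3 →L[ℝ] E3 →L[ℝ] ℝ from
          (G₀ (EuclideanSpace.single j u)).h.inner x)) 0 := by
      rw [← deriv_comp_eq_smul_deriv_of_hasStrictDerivAt
        (fun u : ℝ ↦ (show E3 →L[ℝ] E3 →L[ℝ] ℝ from (G₀ (EuclideanSpace.single j u)).h.inner x))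
        hτ hε.ne' hτ0]
      congr 1
      funext s
      rw [squash_single]
    exact key.trans (congrArg (fun y : E3 →L[ℝ] E3 →L[ℝ] ℝ ↦ (r / 2) • y) hx)
  · -- tangents, `k` part
    funext x
    have hx : deriv (fun u : ℝ ↦ (show E3 →L[ℝ] E3 →L[ℝ] ℝ from
        (G₀ (EuclideanSpace.single j u)).k x)) 0 = b j x := congrFun (htan j).2 x
    have key : deriv (fun s : ℝ ↦ (show E3 →L[ℝ] E3 →L[ℝ] ℝ from
        (G₀ ((r / 2 / Real.sqrt (1 + ‖EuclideanSpace.single j s‖ ^ 2)) •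
          EuclideanSpace.single j s)).k x)) 0 =
        (r / 2) • deriv (fun u : ℝ ↦ (show E3 →L[ℝ] E3 →L[ℝ] ℝ from
          (G₀ (EuclideanSpace.single j u)).k x)) 0 := by
      rw [← deriv_comp_eq_smul_deriv_of_hasStrictDerivAt
        (fun u : ℝ ↦ (show E3 →L[ℝ] E3 →L[ℝ] ℝ from (G₀ (EuclideanSpace.single j u)).k x))
        hτ hε.ne' hτ0]
      congr 1
      funext s
      rw [squash_single]
    exact key.trans (congrArg (fun y : E3 →L[ℝ] E3 →L[ℝ] ℝ ↦ (r / 2) • y) hx)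

end Reduction

/-- **`ChruscielDelay_localConstraintDeformation` reduces to its local, un-squashed core.** The
hypothesis `H` is the fact with the SAME data, vacuum, Killing-freeness and tangent hypotheses
(verbatim) and with the conclusion replaced by what steps (i)–(iii) of the printed assembly deliver:
a family `G₀` through `D`, defined on `ℝᵏ` but controlled only on a parameter ball `‖c‖ < r` —
jointly smooth there, vacuum there, equal to `D` off one compact `K' ⊆ V` there — with the EXACT
prescribed tangents `(aⱼ, bⱼ)` at `c = 0` (Moncrief 1975, §III: no KIDs on small balls around `x₀`;
Chruściel–Delay 2004, Thm. 6.6 with Cor. 5.11: the KID-free vacuum data on `B̄` form a `C^∞` Banach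
submanifold with tangent space `ker P`, giving the local `k`-parameter family by a submanifold
chart composed with `c ↦ Σ cⱼ (bⱼ, aⱼ)`; Chruściel–Delay 2003, Thm. 5.9, Prop. 5.10, Cor. 5.11:
the solutions are `C^∞(B̄)` and extend smoothly by zero across `∂B`). From `H` the fact follows by
step (iv), `InitialDataSet.exists_smoothDataFamily_of_localFamily`. `H` is NOT proved in the tree
(weighted elliptic theory for `L = P P*`, Banach inverse function theorem into `C^∞`, Killing
development of KIDs); this theorem only records that nothing beyond it is needed.
[cite: ChruscielDelay2003, Thm. 5.9, Prop. 5.10, Cor. 5.11] -/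
theorem ChruscielDelay_localConstraintDeformation_of_localFamily
    (H : ∀ (X : Type) [TopologicalSpace X] [ChartedSpace E3 X] [IsManifold (𝓡 3) ∞ X]
      [T2Space X] [SecondCountableTopology X] [ConnectedSpace X]
      (D : InitialDataSet (𝓡 3) X) (𝒟 : VacuumCauchyDevelopment D) (x₀ : X),
      (∀ [D.metric.HasLeviCivita], D.IsVacuumConstraintSolution) →
      (haveI : 𝒟.metric.toPseudoRiemannianMetric.HasLeviCivita := 𝒟.metric.hasLeviCivita
        ∀ V : Set X, IsOpen V → IsConnected V → x₀ ∈ V →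
          ∀ W : Set 𝒟.carrier, IsOpen W → 𝒟.embed '' V ⊆ W →
            ∀ ξ : (p : 𝒟.carrier) → TangentSpace (𝓡 4) p,
              ContMDiffOn (𝓡 4) ((𝓡 4).prod 𝓘(ℝ, E4)) ∞
                (fun p ↦ (Bundle.TotalSpace.mk' E4 p (ξ p) : TangentBundle (𝓡 4) 𝒟.carrier)) W →
              (∀ p ∈ W, ∀ Y₀ Z₀ : TangentSpace (𝓡 4) p,
                𝒟.metric.val p (𝒟.metric.toPseudoRiemannianMetric.leviCivita ξ p Y₀) Z₀ +
                  𝒟.metric.val p Y₀ (𝒟.metric.toPseudoRiemannianMetric.leviCivita ξ p Z₀) = 0) →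
              ∀ x ∈ V, ξ (𝒟.embed x) = 0) →
      ∀ V : Set X, IsOpen V → x₀ ∈ V →
        ∃ U : Set X, IsOpen U ∧ x₀ ∈ U ∧ U ⊆ V ∧
          ∀ (k : ℕ) (a b : Fin k → Π x : X, TangentSpace (𝓡 3) x →L[ℝ] TangentSpace (𝓡 3) x →L[ℝ] ℝ)
            (K : Set X), IsCompact K → K ⊆ U →
            (∀ j, ∃ F : EuclideanSpace ℝ (Fin 1) → InitialDataSet (𝓡 3) X,
              InitialDataSet.IsSmoothDataFamily 1 F ∧ F 0 = D ∧
              (∀ (c : EuclideanSpace ℝ (Fin 1)) (x : X), x ∉ K →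
                (F c).h.inner x = D.h.inner x ∧ (F c).k x = D.k x) ∧
              (fun x : X ↦ deriv (fun s : ℝ ↦ (show E3 →L[ℝ] E3 →L[ℝ] ℝ from
                (F (EuclideanSpace.single 0 s)).h.inner x)) 0) = a j ∧
              (fun x : X ↦ deriv (fun s : ℝ ↦ (show E3 →L[ℝ] E3 →L[ℝ] ℝ from
                (F (EuclideanSpace.single 0 s)).k x)) 0) = b j ∧
              ∀ x : X,
                HasDerivAt (fun s : ℝ ↦
                  haveI := (F (EuclideanSpace.single 0 s)).metric.hasLeviCivita
                  (F (EuclideanSpace.single 0 s)).hamiltonianConstraintFn x) 0 0 ∧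
                ∀ v : TangentSpace (𝓡 3) x,
                  HasDerivAt (fun s : ℝ ↦
                    haveI := (F (EuclideanSpace.single 0 s)).metric.hasLeviCivita
                    (F (EuclideanSpace.single 0 s)).momentumConstraintFn x v) 0 0) →
            ∃ (r : ℝ) (G₀ : EuclideanSpace ℝ (Fin k) → InitialDataSet (𝓡 3) X), 0 < r ∧
              ContMDiffOn (𝓘(ℝ, EuclideanSpace ℝ (Fin k)).prod (𝓡 3))
                ((𝓡 3).prod 𝓘(ℝ, E3 →L[ℝ] E3 →L[ℝ] ℝ)) ∞
                (fun p : EuclideanSpace ℝ (Fin k) × X ↦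
                  TotalSpace.mk' (F := E3 →L[ℝ] E3 →L[ℝ] ℝ)
                    (E := fun x : X ↦ TangentSpace (𝓡 3) x →L[ℝ] TangentSpace (𝓡 3) x →L[ℝ] ℝ)
                    p.2 ((G₀ p.1).h.inner p.2))
                (Metric.ball (0 : EuclideanSpace ℝ (Fin k)) r ×ˢ (univ : Set X)) ∧
              ContMDiffOn (𝓘(ℝ, EuclideanSpace ℝ (Fin k)).prod (𝓡 3))
                ((𝓡 3).prod 𝓘(ℝ, E3 →L[ℝ] E3 →L[ℝ] ℝ)) ∞
                (fun p : EuclideanSpace ℝ (Fin k) × X ↦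
                  TotalSpace.mk' (F := E3 →L[ℝ] E3 →L[ℝ] ℝ)
                    (E := fun x : X ↦ TangentSpace (𝓡 3) x →L[ℝ] TangentSpace (𝓡 3) x →L[ℝ] ℝ)
                    p.2 ((G₀ p.1).k p.2))
                (Metric.ball (0 : EuclideanSpace ℝ (Fin k)) r ×ˢ (univ : Set X)) ∧
              G₀ 0 = D ∧
              (∀ c : EuclideanSpace ℝ (Fin k), ‖c‖ < r →
                ∀ [(G₀ c).metric.HasLeviCivita], (G₀ c).IsVacuumConstraintSolution) ∧
              (∃ K' : Set X, IsCompact K' ∧ K' ⊆ V ∧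
                ∀ c : EuclideanSpace ℝ (Fin k), ‖c‖ < r → ∀ x : X, x ∉ K' →
                  (G₀ c).h.inner x = D.h.inner x ∧ (G₀ c).k x = D.k x) ∧
              ∀ j, (fun x : X ↦ deriv (fun s : ℝ ↦ (show E3 →L[ℝ] E3 →L[ℝ] ℝ from
                  (G₀ (EuclideanSpace.single j s)).h.inner x)) 0) = a j ∧
                (fun x : X ↦ deriv (fun s : ℝ ↦ (show E3 →L[ℝ] E3 →L[ℝ] ℝ from
                  (G₀ (EuclideanSpace.single j s)).k x)) 0) = b j) :
    ChruscielDelay_localConstraintDeformation := by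
  intro X _ _ _ _ _ _ D 𝒟 x₀ hvac hKID V hV hx₀
  obtain ⟨U, hU, hxU, hUV, hloc⟩ := H X D 𝒟 x₀ hvac hKID V hV hx₀
  refine ⟨U, hU, hxU, hUV, fun k a b K hK hKU htan ↦ ?_⟩
  obtain ⟨r, G₀, hr, hh, hk, h0, hvac', hsupp, htan'⟩ := hloc k a b K hK hKU htan
  exact D.exists_smoothDataFamily_of_localFamily V a b hr G₀ hh hk h0 hvac' hsupp htan'

end Literature.Geometry.Lorentzian

end
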